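import Literature.NumberTheory.LFunctions.LagariasDifferencedXiSpacingDistributionProofs
import Literature.NumberTheory.LFunctions.LagariasDifferencedXiCharRHProofs
import Literature.NumberTheory.LFunctions.DirichletLZeroCounting
import Literature.NumberTheory.LFunctions.DirichletLFunctionBounds
import Literature.NumberTheory.LFunctions.DirichletLogDerivGRHLogPowerBound
import Literature.NumberTheory.LFunctions.DirichletLFunctionLogDerivMeanValue
import Literature.NumberTheory.LFunctions.LagariasSpacingAveragedPhaseProofs
import HarnessLib

/-!
# Lagarias 2005, Theorem 5.2: trivial limiting distribution of the normalised zero spacings of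
# `A_{h,θ}(s, χ)`, `B_{h,θ}(s, χ)` — the character transplant of Theorem 4.1

LINE 1 — LABEL: RH-FREE literature (Theorem 5.2 (1)); Theorem 5.2 (2) is a GRH(χ)-CONSEQUENCE whose
binder `χ.RiemannHypothesis` is a hypothesis of the statement, never dropped and never asserted.
bears_on: LADDER-RH B-C/B-P (COLUMN 6, de Branges) as corpus bookkeeping (cell rh-crit/dbl, row
«dbl:R14-La05T5.2(1)»). WHAT THIS IS NOT: a statement about the critical-line zeros of the AUXILIARY
entire functions `A_{h,θ}(s, χ) = ½(E + E♯)`, `B_{h,θ}(s, χ)` built from `ξ(s + h, χ)` — not about zeros of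
`L(s, χ)`, not a route, not progress toward RH or GRH; nothing here bears on the truth of RH.

Source: J. C. Lagarias, *Zero spacing distributions for differenced L-functions*, Acta Arith. 120 (2005)
159–184 = arXiv:math/0601653 [Lagarias2005], **Theorem 5.2** (arXiv p. 10; held text
`paper:arxiv-math_0601653` p0010:L124–141, proof L143–175): for a primitive non-principal `χ` and
`k ≥ 1`, (1) for `|h| ≥ ½`, `0 ≤ θ < 2π`, the `k` consecutive normalised zero spacings of `A_{h,θ}(s, χ)`
and `B_{h,θ}(s, χ)` have the trivial limiting distribution `δ_{(1,…,1)}` (`lagarias2005_thm_5_2_1`,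
typed in `LagariasDifferencedXiSpacings.lean`); (2) under the Riemann hypothesis for `L(s, χ)` the
same for `0 < |h| < ½` (`lagarias2005_thm_5_2_2`). Printed proof: "This is established in a manner
similar to Theorem 4.1. The key ingredient is an analogue of the three parts of Lemma 4.1, which cover
`|h| > ½`, `|h| = ½` and `0 < |h| < ½`, respectively. Here the analogue of part (1), that
`R_h(T) = O(1)`, follows from the absolute convergence of the Dirichlet series for `−L′/L(s, χ)` in
`Re(s) > 1`" (p0010:L143–151); the analogues of parts (2) (`|L′/L(1 + iT, χ)| = O(log|T|/log log|T|)`)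
and (3) (`O((log|T|)^{2−2σ})` under GRH) are referred to [IK04] (p0010:L152–175).

## What is proved here, and modulo what (0 definitions, 0 named facts)

* `Lagarias2005CharSpacing.hasTrivialSpacingDistribution_critParts_of_velocity` — the GENERIC core
  of Theorems 4.1/5.2: for an entire `E` whose phase velocity `v(t) = Re E′/E(½ + it)` is positive for
  every `t` and satisfies `|v(t) − ½ log|t|| ≤ η log|t|` eventually for every `η > 0`, the `k`
  consecutive normalised zero spacings of `A = ½(E + E♯)` and of `B = (i/2)(E − E♯)` have the trivial
  limiting distribution (polar form of `E(½ + it)`, zero dictionary `A = 0 ⟺ cos Φ = 0`,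
  `B = 0 ⟺ sin Φ = 0`, then the phase-lattice layer of the Theorem 4.1 file,
  `Lagarias2005Spacing.hasTrivialSpacingDistribution_of_phase`, reused BY NAME).
* `Lagarias2005CharSpacing.abs_re_logDeriv_dirichletXi_sub_le` — the velocity of `ξ(s, χ)` on vertical
  lines: `|Re ξ′/ξ(s, χ) − ½ log(N|Im s|/2π) − Re L′/L(s, χ)| ≤ (Re s + κ + 4)/(2|Im s|)` for
  `Re s > 0`, `|Im s| ≥ 1`, `L(s, χ) ≠ 0` (`χ ≠ χ₀`), from the tree's
  `ξ′/ξ = ½ log N + Γℝ′/Γℝ(s + κ) + L′/L` (`DirichletTheta.logDeriv_dirichletXi_eq`),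
  `Γℝ′/Γℝ = −½ log π + ½ψ(·/2)` (`logDeriv_Gammaℝ`) and the vertical Stirling bound for `Re ψ`.
* **`hasTrivialSpacingDistribution_diffXiChar_of_half_lt` — Theorem 5.2 (1) for `|h| > ½`,
  UNCONDITIONALLY** (every real `θ`, every `k`): the analogue of Lemma 4.1 (1) is the tree's uniform
  bound `‖L′/L(s, χ)‖ ≤ 1/(σ − 1) + K₀` (`DirichletZFR.exists_norm_logDeriv_le`); positivity of the
  velocity is the strict Hermite–Biehler phase velocity (`re_logDeriv_pos_of_critHB` with
  `diffXiCharErot_critHB`, i.e. Lemma 5.1 (1)); `h < 0` reduces to `−h` through the root number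
  (`diffXiCharArot_neg`, `diffXiCharBrot_neg`).
* `lagarias2005_thm_5_2_1_of_logDeriv_one` — Theorem 5.2 (1) BY NAME from the POINTWISE endpoint
  input as an explicit hypothesis binder (the `χ`-analogue of Lemma 4.1 (2): for `χ` primitive
  non-principal, `L′/L(1 + it, χ) = o(log|t|)`; the tree proves only `O(log)`-type pointwise bounds for
  `L′/L` near `σ = 1`) — the printed road, kept for the record; the unconditional discharge
  `lagarias2005_thm_5_2_1_holds` below goes through the AVERAGED input instead (Parts G, J).
* `lagarias2005_thm_5_2_2_of_logDeriv` — Theorem 5.2 (2) BY NAME (GRH binder kept) modulo the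
  `χ`-analogue of Lemma 4.1 (3) as an explicit hypothesis binder (`L′/L(½ + h + it, χ) = o(log|t|)`
  under GRH(χ), `0 < h < ½`); positivity under GRH is `diffXiCharErot_critHB_of_rh` (Lemma 5.1 (2)).
* **`lagarias2005_thm_5_2_2_holds : lagarias2005_thm_5_2_2` — Theorem 5.2 (2) DISCHARGED** (as a
  GRH(χ)-consequence, the binder kept; Part I): the binder of the previous item is Littlewood's
  log-power bound `‖L′/L(σ + it, χ)‖ ≤ C (log|t|)^{2−2σ}` (`½ < σ < 1`, `|t| ≥ 3`, GRH(χ)) of the tree in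
  its `o(log|t|)` form `LittlewoodGRH.norm_logDeriv_LFunction_le_mul_log_of_rh`
  (`DirichletLogDerivGRHLogPowerBound.lean`).
* **`lagarias2005_thm_5_2_1_holds : lagarias2005_thm_5_2_1` — Theorem 5.2 (1) DISCHARGED,
  UNCONDITIONALLY** (Part J): at the endpoint `|h| = ½` the generic core is run in its AVERAGED form
  `hasTrivialSpacingDistribution_critParts_of_velocity_integral` (the averaged phase-lattice lemma
  `Lagarias2005AvgSpacing.hasTrivialSpacingDistribution_of_phase_of_integral_pos` of
  `LagariasSpacingAveragedPhaseProofs.lean`, BY NAME) fed by Part G; `|h| > ½` as above.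
* Part G (`abs_velocity_sub_half_log_le_add`, `exists_integral_abs_velocity_sub_le`,
  `integral_abs_velocity_sub_le_mul_log`) — the endpoint `|h| = ½` velocity estimate IN THE MEAN:
  from `t ↦ L′/L(1 + it, χ)` continuous with `∫_{−T}^{T} ‖L′/L(1 + it, χ)‖ dt ≤ C·T` (`T ≥ 1`) to
  `∫_{−T}^{T} |v(t) − ½ log|t|| dt ≤ η·T log T` for `T ≥ T₀(η)`, `v` the phase velocity of
  `E_{½,θ}(·, χ)` — the hypothesis of the averaged phase-lattice lemma (cell row R14-S).

## References

* [Lagarias2005] J. C. Lagarias, Acta Arith. 120 (2005) 159–184 = arXiv:math/0601653 — Theorem 5.2 and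
  its proof (arXiv p. 10), Theorem 4.1 (pp. 8–9), Lemma 4.1, Lemma 5.1.
* [MontgomeryVaughan2007] H. L. Montgomery, R. C. Vaughan, *Multiplicative Number Theory I*, (10.19),
  Lemma 11.1 (the inputs `logDeriv_dirichletXi_eq`, `DirichletZFR.exists_norm_logDeriv_le`), §13.2.1
  Exercise 2 (b) (Littlewood's bound under GRH, the input `norm_logDeriv_LFunction_le_mul_log_of_rh`).
-/

noncomputable section

open Complex Set MeasureTheory Filter Topology intervalIntegral Metric
open scoped Real ComplexConjugate Interval

namespace Literature.NumberTheory.LFunctions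

namespace Lagarias2005CharSpacing

open Lagarias2005Spacing

/-! ## A. Polar form of a non-vanishing `C¹` path -/

/-- ODE uniqueness: a nowhere-vanishing `C¹` path `W : ℝ → ℂ` is `W(0) · exp(∫₀ᵗ W′/W)`. [folklore] -/
private theorem eq_mul_exp_integral_of_hasDerivAt {W W' : ℝ → ℂ} (hW : ∀ t, HasDerivAt W (W' t) t)
    (hW' : Continuous W') (h0 : ∀ t, W t ≠ 0) (t : ℝ) :
    W t = W 0 * Complex.exp (∫ u in (0:ℝ)..t, W' u / W u) := by
  have hWc : Continuous W := continuous_iff_continuousAt.2 fun t ↦ (hW t).continuousAt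
  have hq : Continuous fun u ↦ W' u / W u := hW'.div hWc h0
  have hL : ∀ t, HasDerivAt (fun t ↦ ∫ u in (0:ℝ)..t, W' u / W u) (W' t / W t) t := fun t ↦
    (hq.integral_hasStrictDerivAt 0 t).hasDerivAt
  have hQ : ∀ t, HasDerivAt (fun t ↦ W t * Complex.exp (-(∫ u in (0:ℝ)..t, W' u / W u))) 0 t := by
    intro t
    have h1 : HasDerivAt (fun s ↦ Complex.exp (-(∫ u in (0:ℝ)..s, W' u / W u)))
        (Complex.exp (-(∫ u in (0:ℝ)..t, W' u / W u)) * -(W' t / W t)) t := ((hL t).neg).cexp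
    have h2 : HasDerivAt (fun s ↦ W s * Complex.exp (-(∫ u in (0:ℝ)..s, W' u / W u)))
        (W' t * Complex.exp (-(∫ u in (0:ℝ)..t, W' u / W u)) +
          W t * (Complex.exp (-(∫ u in (0:ℝ)..t, W' u / W u)) * -(W' t / W t))) t := (hW t).mul h1
    have ht0 := h0 t
    have e : W' t * Complex.exp (-(∫ u in (0:ℝ)..t, W' u / W u)) +
        W t * (Complex.exp (-(∫ u in (0:ℝ)..t, W' u / W u)) * -(W' t / W t)) = 0 := by
      field_simp
      ring
    rwa [e] at h2
  have hconst : ∀ t, W t * Complex.exp (-(∫ u in (0:ℝ)..t, W' u / W u)) = W 0 := by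
    intro t
    have hd : Differentiable ℝ (fun t ↦ W t * Complex.exp (-(∫ u in (0:ℝ)..t, W' u / W u))) :=
      fun t ↦ (hQ t).differentiableAt
    have := is_const_of_deriv_eq_zero hd (fun t ↦ (hQ t).deriv) t 0
    simpa using this
  have h := hconst t
  calc W t = W t * Complex.exp (-(∫ u in (0:ℝ)..t, W' u / W u)) *
      Complex.exp (∫ u in (0:ℝ)..t, W' u / W u) := by
        rw [mul_assoc, ← Complex.exp_add, neg_add_cancel, Complex.exp_zero, mul_one]
    _ = W 0 * Complex.exp (∫ u in (0:ℝ)..t, W' u / W u) := by rw [h]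

/-- Zero criteria in polar form: with `Φ(t) = arg W(0) + Im ∫₀ᵗ W′/W`, `Re W(t) = 0 ⟺ cos Φ(t) = 0` and
`Im W(t) = 0 ⟺ sin Φ(t) = 0`. [folklore] -/
private theorem re_eq_zero_iff_cos_of_hasDerivAt {W W' : ℝ → ℂ} (hW : ∀ t, HasDerivAt W (W' t) t)
    (hW' : Continuous W') (h0 : ∀ t, W t ≠ 0) (t : ℝ) :
    ((W t).re = 0 ↔ Real.cos (arg (W 0) + (∫ u in (0:ℝ)..t, W' u / W u).im) = 0) ∧
      ((W t).im = 0 ↔ Real.sin (arg (W 0) + (∫ u in (0:ℝ)..t, W' u / W u).im) = 0) := by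
  set L : ℂ := ∫ u in (0:ℝ)..t, W' u / W u with hL
  have hpol : W 0 = ‖W 0‖ * Complex.exp (arg (W 0) * I) := (Complex.norm_mul_exp_arg_mul_I (W 0)).symm
  have key : W t = ‖W 0‖ * Complex.exp (arg (W 0) * I + L) := by
    rw [eq_mul_exp_integral_of_hasDerivAt hW hW' h0 t, ← hL, Complex.exp_add, ← mul_assoc, ← hpol]
  have hnorm : ‖W t‖ = ‖W 0‖ * Real.exp L.re := by
    rw [key, norm_mul, Complex.norm_real, Real.norm_eq_abs, abs_norm, Complex.norm_exp]
    simp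
  have hre' : (arg (W 0) * I + L).re = L.re := by simp
  have him' : (arg (W 0) * I + L).im = arg (W 0) + L.im := by simp
  have hre : (W t).re = ‖W t‖ * Real.cos (arg (W 0) + L.im) := by
    rw [hnorm]
    conv_lhs => rw [key]
    rw [Complex.re_ofReal_mul, Complex.exp_re, hre', him']; ring
  have him : (W t).im = ‖W t‖ * Real.sin (arg (W 0) + L.im) := by
    rw [hnorm]
    conv_lhs => rw [key]
    rw [Complex.im_ofReal_mul, Complex.exp_im, hre', him']; ring
  have hn : ‖W t‖ ≠ 0 := norm_ne_zero_iff.2 (h0 t)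
  exact ⟨by rw [hre, mul_eq_zero, or_iff_right hn], by rw [him, mul_eq_zero, or_iff_right hn]⟩

/-- `Im ∫ₐᵇ q = ∫ₐᵇ Im q`. [folklore] -/
private theorem im_intervalIntegral_eq {q : ℝ → ℂ} {a b : ℝ} (hq : IntervalIntegrable q volume a b) :
    (∫ u in a..b, q u).im = ∫ u in a..b, (q u).im := by
  have := ((Complex.imCLM : ℂ →L[ℝ] ℝ).intervalIntegral_comp_comm hq).symm
  simpa using this

/-! ## D. From a positive, logarithmically growing line velocity of an entire `E` to the trivial
spacing distribution of `A = ½(E + E♯)` and `B = (i/2)(E − E♯)` -/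

/-- The line velocity `t ↦ Re E′/E(½ + it)` of an entire `E` without zeros on the critical line is
continuous. [folklore] -/
private theorem continuous_re_logDeriv_critLine {E : ℂ → ℂ} (hE : Differentiable ℂ E)
    (hne : ∀ t : ℝ, E (1 / 2 + t * I) ≠ 0) :
    Continuous fun t : ℝ ↦ (logDeriv E (1 / 2 + t * I)).re := by
  have hdc : Continuous (deriv E) := (hE.contDiff (n := 1)).continuous_deriv le_rfl
  refine Complex.continuous_re.comp (continuous_iff_continuousAt.2 fun u ↦ ?_)
  have h1 : ContinuousAt (fun u : ℝ ↦ (1 / 2 : ℂ) + u * I) u := by fun_prop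
  have h2 : ContinuousAt (logDeriv E) ((1 / 2 : ℂ) + u * I) := by
    have e : logDeriv E = fun z ↦ deriv E z / E z := funext fun z ↦ logDeriv_apply E z
    rw [e]
    exact hdc.continuousAt.div hE.continuous.continuousAt (hne u)
  exact h2.comp (f := fun u : ℝ ↦ (1 / 2 : ℂ) + u * I) h1

/-- **Polar phase of `E` on the critical line.** For an entire `E` with no zeros on `Re s = ½` there
is a `C¹` phase `Ψ(t) = arg E(½) + Im ∫₀ᵗ iE′/E(½ + iu) du` with `Ψ′(t) = Re E′/E(½ + it)` such that the
critical zeros of `A = ½(E + E♯)` are the solutions of `sin(Ψ(t) + π/2) = 0` and those of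
`B = (i/2)(E − E♯)` the solutions of `sin Ψ(t) = 0` (`E(½ + it) = |E(½ + it)| e^{iΨ(t)}`).
[cite: Lagarias2005, Theorem 4.1, proof (arXiv pp. 8–9)] -/
private theorem exists_phase_critParts {E : ℂ → ℂ} (hE : Differentiable ℂ E)
    (hE0 : ∀ t : ℝ, E (1 / 2 + t * I) ≠ 0) :
    ∃ Ψ : ℝ → ℝ, (∀ t : ℝ, HasDerivAt Ψ ((logDeriv E (1 / 2 + t * I)).re) t) ∧
      (∀ t : ℝ, t ∈ critZeroOrdinates (critRePart E) ↔ Real.sin (Ψ t + π / 2) = 0) ∧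
      (∀ t : ℝ, t ∈ critZeroOrdinates (critImPart E) ↔ Real.sin (Ψ t) = 0) := by
  -- the velocity `v(t) = Re E'/E(½ + it)`
  obtain ⟨v, hvdef⟩ : ∃ v : ℝ → ℝ, v = fun t : ℝ ↦ (logDeriv E ((1 / 2 : ℂ) + t * I)).re := ⟨_, rfl⟩
  have hvpt : ∀ t : ℝ, (logDeriv E (1 / 2 + t * I)).re = v t := fun t ↦ by rw [hvdef]
  have hdc : Continuous (deriv E) := (hE.contDiff (n := 1)).continuous_deriv le_rfl
  have hcontv : Continuous v := by rw [hvdef]; exact continuous_re_logDeriv_critLine hE hE0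
  -- the phase `φ(t) = ∫₀ᵗ v`
  set φ : ℝ → ℝ := fun t ↦ ∫ u in (0:ℝ)..t, v u with hφ
  have hφd : ∀ t : ℝ, HasDerivAt φ (v t) t := fun t ↦ (hcontv.integral_hasStrictDerivAt 0 t).hasDerivAt
  -- the path `W(t) = E(½ + it)` and its polar form
  set W : ℝ → ℂ := fun t ↦ E ((1 / 2 : ℂ) + t * I) with hW
  set W' : ℝ → ℂ := fun t ↦ deriv E ((1 / 2 : ℂ) + t * I) * I with hW'
  have hWd : ∀ t, HasDerivAt W (W' t) t := by
    intro t
    have hp : HasDerivAt (fun t : ℝ ↦ (1 / 2 : ℂ) + t * I) I t := by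
      have := ((hasDerivAt_id t).ofReal_comp).mul_const I |>.const_add (1 / 2 : ℂ)
      simpa using this
    have hE' : HasDerivAt E (deriv E ((1 / 2 : ℂ) + t * I)) ((1 / 2 : ℂ) + t * I) := (hE _).hasDerivAt
    have := hE'.comp t hp
    simpa [hW, hW', Function.comp_def] using this
  have hW'c : Continuous W' := (hdc.comp (by fun_prop)).mul continuous_const
  have hWc : Continuous W := continuous_iff_continuousAt.2 fun t ↦ (hWd t).continuousAt
  have hW0 : ∀ t, W t ≠ 0 := fun t ↦ hE0 t
  have hquot : ∀ t, W' t / W t = I * logDeriv E ((1 / 2 : ℂ) + t * I) := fun t ↦ by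
    simp only [hW, hW']
    rw [logDeriv_apply]
    ring
  have hIm : ∀ t, (∫ u in (0:ℝ)..t, W' u / W u).im = φ t := by
    intro t
    have hi : IntervalIntegrable (fun u ↦ W' u / W u) volume 0 t := (hW'c.div hWc hW0).intervalIntegrable 0 t
    rw [im_intervalIntegral_eq hi]
    simp only [hquot, mul_im, I_re, I_im, zero_mul, one_mul, zero_add, hφ, hvdef]
  refine ⟨fun t ↦ arg (W 0) + φ t, fun t ↦ ?_, fun t ↦ ?_, fun t ↦ ?_⟩
  · rw [hvpt]; exact (hφd t).const_add _
  · rw [mem_critZeroOrdinates, critRePart_critical_eq_zero_iff]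
    change (W t).re = 0 ↔ _
    rw [(re_eq_zero_iff_cos_of_hasDerivAt hWd hW'c hW0 t).1, hIm, Real.sin_add_pi_div_two]
  · rw [mem_critZeroOrdinates, critImPart_critical_eq_zero_iff]
    change (W t).im = 0 ↔ _
    rw [(re_eq_zero_iff_cos_of_hasDerivAt hWd hW'c hW0 t).2, hIm]

/-- **Generic core of Theorems 4.1 / 5.2.** Let `E` be entire with phase velocity
`v(t) = Re E′/E(½ + it) > 0` for every real `t` (so `E(½ + it) ≠ 0`) and
`|v(t) − ½ log|t|| ≤ η log|t|` for `|t| ≥ T₀(η)`, every `η > 0`. Then for every `k` the `k` consecutive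
normalised zero spacings of `A = ½(E + E♯)` and of `B = (i/2)(E − E♯)` have the trivial limiting
distribution: the zeros of `A` (resp. `B`) on the critical line are the solutions of `cos Φ(t) = 0`
(resp. `sin Φ(t) = 0`), `Φ` the continuous argument of `E(½ + it)`, `Φ′ = v`, and the phase-lattice
analysis of the Theorem 4.1 file (`Lagarias2005Spacing.hasTrivialSpacingDistribution_of_phase`) applies,
a uniform lower bound `v ≥ c > 0` coming from `v ∼ ½ log|t|` far out and compactness.
[cite: Lagarias2005, Theorem 4.1, proof (arXiv pp. 8–9) and Theorem 5.2, proof (arXiv p. 10 L143–147)] -/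
theorem hasTrivialSpacingDistribution_critParts_of_velocity {E : ℂ → ℂ} (hE : Differentiable ℂ E)
    (hpos : ∀ t : ℝ, 0 < (logDeriv E (1 / 2 + t * I)).re)
    (hv : ∀ η : ℝ, 0 < η → ∃ T₀ : ℝ, ∀ t : ℝ, T₀ ≤ |t| →
      |(logDeriv E (1 / 2 + t * I)).re - 1 / 2 * Real.log (|t|)| ≤ η * Real.log |t|) (k : ℕ) :
    HasTrivialSpacingDistribution (critRePart E) k ∧ HasTrivialSpacingDistribution (critImPart E) k := by
  have hE0 : ∀ t : ℝ, E ((1 / 2 : ℂ) + t * I) ≠ 0 := fun t h0 ↦ by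
    have := hpos t
    simp only [logDeriv_apply, h0, div_zero, zero_re] at this
    exact lt_irrefl _ this
  obtain ⟨Ψ, hΨ, hzA, hzB⟩ := exists_phase_critParts hE hE0
  -- the velocity `v(t) = Re E'/E(½ + it)` as a function
  obtain ⟨v, hvdef⟩ : ∃ v : ℝ → ℝ, v = fun t : ℝ ↦ (logDeriv E ((1 / 2 : ℂ) + t * I)).re := ⟨_, rfl⟩
  have hvpt : ∀ t : ℝ, (logDeriv E (1 / 2 + t * I)).re = v t := fun t ↦ by rw [hvdef]
  have hpos' : ∀ t : ℝ, 0 < v t := fun t ↦ by rw [← hvpt]; exact hpos t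
  have hv' : ∀ η : ℝ, 0 < η → ∃ T₀ : ℝ, ∀ t : ℝ, T₀ ≤ |t| →
      |v t - 1 / 2 * Real.log (|t|)| ≤ η * Real.log |t| := by
    intro η hη
    obtain ⟨T₀, hT₀⟩ := hv η hη
    exact ⟨T₀, fun t ht ↦ by rw [← hvpt]; exact hT₀ t ht⟩
  have hcontv : Continuous v := by rw [hvdef]; exact continuous_re_logDeriv_critLine hE hE0
  -- a uniform lower bound `c ≤ v`
  obtain ⟨T₀, hT₀⟩ := hv' (1 / 4) (by norm_num)
  set T₁ : ℝ := max T₀ 2 with hT₁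
  have hlog2 : 0 < Real.log 2 := Real.log_pos (by norm_num)
  have hfar : ∀ t : ℝ, T₁ ≤ |t| → 1 / 4 * Real.log 2 ≤ v t := by
    intro t ht
    have h2t : 2 ≤ |t| := le_trans (le_max_right _ _) ht
    have hlogt : Real.log 2 ≤ Real.log |t| := Real.log_le_log (by norm_num) h2t
    have hb := (abs_le.1 (hT₀ t (le_trans (le_max_left _ _) ht))).1
    linarith
  have hT₁0 : 0 ≤ T₁ := le_trans (by norm_num) (le_max_right T₀ 2)
  obtain ⟨t₀, -, ht₀min⟩ := (isCompact_Icc (a := -T₁) (b := T₁)).exists_isMinOn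
    (nonempty_Icc.2 (by linarith)) hcontv.continuousOn
  set c : ℝ := min (1 / 4 * Real.log 2) (v t₀) with hcdef
  have hc : 0 < c := lt_min (by positivity) (hpos' t₀)
  have hcv : ∀ t, c ≤ v t := by
    intro t
    rcases le_or_gt T₁ |t| with ht | ht
    · exact le_trans (min_le_left _ _) (hfar t ht)
    · have hmem : t ∈ Icc (-T₁) T₁ := abs_le.1 ht.le
      exact le_trans (min_le_right _ _) ((isMinOn_iff.1 ht₀min) t hmem)
  -- the phase-lattice layer of the Theorem 4.1 file
  have hΨ' : ∀ t, HasDerivAt Ψ (v t) t := fun t ↦ by rw [← hvpt]; exact hΨ t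
  have hΨA : ∀ t, HasDerivAt (fun t ↦ Ψ t + π / 2) (v t) t := fun t ↦ (hΨ' t).add_const _
  exact ⟨hasTrivialSpacingDistribution_of_phase hΨA hc hcv hv' hzA k,
    hasTrivialSpacingDistribution_of_phase hΨ' hc hcv hv' hzB k⟩

/-! ## E. The phase velocity of `ξ(s, χ)` on a vertical line -/

section Velocity

variable {N : ℕ} [NeZero N] {χ : DirichletCharacter ℂ N}

/-- **The phase velocity of `ξ(·, χ)` on a vertical line** (the `χ`-analogue of the display after
(4.4): `Re ξ′/ξ(s, χ) = ½ log(N|t|/2π) + O(1/|t|) + Re L′/L(s, χ)`), with an explicit constant: for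
`χ ≠ χ₀`, `Re s > 0`, `|Im s| ≥ 1`, `L(s, χ) ≠ 0`,
`|Re ξ′/ξ(s, χ) − ½ log(N|Im s|/2π) − Re L′/L(s, χ)| ≤ (Re s + κ + 4)/(2|Im s|)`, from
`ξ′/ξ = ½ log N + Γℝ′/Γℝ(s + κ) + L′/L` (`DirichletTheta.logDeriv_dirichletXi_eq`),
`Γℝ′/Γℝ(w) = −½ log π + ½ ψ(w/2)` (`logDeriv_Gammaℝ`) and the vertical Stirling bound
`|Re ψ(w) − log ‖w‖| ≤ 1/(2‖w‖²) + π/(4|Im w|)` (`abs_re_digamma_sub_log_norm_le`).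
[cite: Lagarias2005, Theorem 5.2, proof (arXiv p. 10 L143–147) with Theorem 4.1, proof (display after (4.4), p. 9)] -/
theorem abs_re_logDeriv_dirichletXi_sub_le (h1 : χ ≠ 1) {s : ℂ} (hs : 0 < s.re) (ht : 1 ≤ |s.im|)
    (hL : χ.LFunction s ≠ 0) :
    |(logDeriv (DirichletTheta.dirichletXi χ) s).re - 1 / 2 * Real.log ((N : ℝ) * |s.im| / (2 * π)) -
        (deriv χ.LFunction s / χ.LFunction s).re| ≤ (s.re + charParity χ + 4) / (2 * |s.im|) := by
  have hπ := Real.pi_pos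
  have hN : (0 : ℝ) < N := Nat.cast_pos.2 (NeZero.pos N)
  have him0 : s.im ≠ 0 := fun h ↦ by rw [h, abs_zero] at ht; linarith
  have htpos : 0 < |s.im| := abs_pos.2 him0
  have hκ0 : (0 : ℝ) ≤ charParity χ := Nat.cast_nonneg _
  -- `ξ'/ξ = ½ log N + Γℝ'/Γℝ(s + κ) + L'/L`
  have hsk : 0 < (s + charParity χ).re := by simp; linarith
  have hpole : ∀ m : ℕ, (s + charParity χ) / 2 ≠ -m := half_ne_neg_nat_of_re_pos' hsk
  rw [logDeriv_apply, DirichletTheta.logDeriv_dirichletXi_eq h1 hs hL,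
    Literature.NumberTheory.LFunctions.logDeriv_Gammaℝ hpole, ← Complex.ofReal_log hπ.le, logDeriv_apply]
  set w : ℂ := (s + charParity χ) / 2 with hw
  have hwre : 0 < w.re := by rw [hw, Complex.div_ofNat_re]; exact half_pos hsk
  have hwim : w.im = s.im / 2 := by rw [hw, Complex.div_ofNat_im]; simp
  have hwim0 : w.im ≠ 0 := by rw [hwim]; exact div_ne_zero him0 two_ne_zero
  have hψ := Literature.Analysis.SpecialFunctions.Complex.abs_re_digamma_sub_log_norm_le hwre hwim0
  have hwnorm : |s.im| / 2 ≤ ‖w‖ := by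
    have := Complex.abs_im_le_norm w
    rwa [hwim, abs_div, abs_two] at this
  have hw0 : 0 < ‖w‖ := lt_of_lt_of_le (by positivity) hwnorm
  have hlogt : Real.log ((N : ℝ) * |s.im| / (2 * π)) =
      Real.log N + Real.log (|s.im| / 2) - Real.log π := by
    rw [show (N : ℝ) * |s.im| / (2 * π) = N * (|s.im| / 2) / π by ring,
      Real.log_div (by positivity) hπ.ne', Real.log_mul hN.ne' (by positivity)]
  -- the two pieces
  have hD : |(Complex.digamma w).re - Real.log ‖w‖| ≤ 4 / |s.im| := by
    refine hψ.trans ?_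
    have hsq' : |s.im| * |s.im| ≤ 4 * ‖w‖ ^ 2 := by nlinarith [hwnorm, abs_nonneg s.im]
    have h1' : 1 / (2 * ‖w‖ ^ 2) ≤ 2 / |s.im| := by
      rw [div_le_div_iff₀ (by positivity) htpos]
      nlinarith [hsq', ht]
    have h2' : π / (4 * |w.im|) ≤ 2 / |s.im| := by
      rw [hwim, abs_div, abs_two, show 4 * (|s.im| / 2) = 2 * |s.im| by ring,
        div_le_div_iff₀ (by positivity) htpos]
      nlinarith [Real.pi_le_four, htpos]
    have e4 : 2 / |s.im| + 2 / |s.im| = 4 / |s.im| := by ring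
    linarith
  have hLg : |Real.log ‖w‖ - Real.log (|s.im| / 2)| ≤ (s.re + charParity χ) / |s.im| := by
    have ht2 : 0 < |s.im| / 2 := by positivity
    have hlo : Real.log (|s.im| / 2) ≤ Real.log ‖w‖ := Real.log_le_log ht2 hwnorm
    have hsnorm : ‖s + charParity χ‖ ≤ (s.re + charParity χ) + |s.im| := by
      have e' : ((s.re + charParity χ : ℝ) : ℂ) + (s.im : ℂ) * I = s + charParity χ := by
        apply Complex.ext <;> simp
      have := norm_add_le ((s.re + charParity χ : ℝ) : ℂ) ((s.im : ℂ) * I)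
      rw [e', Complex.norm_real, Real.norm_eq_abs, abs_of_pos (by linarith), norm_mul, Complex.norm_I,
        mul_one, Complex.norm_real, Real.norm_eq_abs] at this
      exact this
    have hwle : ‖w‖ ≤ ((s.re + charParity χ) + |s.im|) / 2 := by
      rw [hw, norm_div, Complex.norm_ofNat]; linarith
    have hhi : Real.log ‖w‖ - Real.log (|s.im| / 2) ≤ (s.re + charParity χ) / |s.im| := by
      rw [← Real.log_div hw0.ne' ht2.ne']
      refine (Real.log_le_sub_one_of_pos (by positivity)).trans ?_
      rw [sub_le_iff_le_add, div_le_iff₀ ht2]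
      have e' : ((s.re + charParity χ) / |s.im| + 1) * (|s.im| / 2) = ((s.re + charParity χ) + |s.im|) / 2 := by
        field_simp
      rw [e']; exact hwle
    rw [abs_of_nonneg (by linarith)]
    exact hhi
  obtain ⟨hD1, hD2⟩ := abs_le.1 hD
  obtain ⟨hL1, hL2⟩ := abs_le.1 hLg
  have eK : (s.re + charParity χ + 4) / (2 * |s.im|) = 1 / 2 * (4 / |s.im| + (s.re + charParity χ) / |s.im|) := by
    field_simp
    ring
  simp only [Complex.add_re, Complex.neg_re, Complex.div_ofNat_re, Complex.ofReal_re, neg_div,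
    hlogt]
  rw [eK, abs_le]
  constructor <;> linarith

/-- `E_{h,θ}′/E_{h,θ}(s, χ) = ξ′/ξ(s + h, χ)`: the rotation `e^{iθ}` drops out of the logarithmic
derivative and the shift passes through. [cite: Lagarias2005, §5 p.10 (E_{h,θ}(s, χ) = e^{iθ} ξ(s+h, χ))] -/
theorem logDeriv_diffXiCharErot (χ : DirichletCharacter ℂ N) (h θ : ℝ) (s : ℂ) :
    logDeriv (diffXiCharErot χ h θ) s = logDeriv (DirichletTheta.dirichletXi χ) (s + h) := by
  have hc : Complex.exp (θ * I) ≠ 0 := Complex.exp_ne_zero _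
  have hfun : diffXiCharErot χ h θ = fun z ↦ Complex.exp (θ * I) *
      (fun z ↦ DirichletTheta.dirichletXi χ (z + h)) z := by
    funext z; rw [diffXiCharErot_apply, diffXiCharE_apply]
  rw [hfun, logDeriv_const_mul s _ hc, logDeriv_apply, logDeriv_apply, deriv_comp_add_const]

/-- **From a bound `o(log|t|)` for `L′/L` on the line `Re s = ½ + h` to the velocity estimate**
`|Re E_{h,θ}′/E_{h,θ}(½ + it, χ) − ½ log|t|| ≤ η log|t|` (`|t| ≥ T₀(η)`, every `η > 0`), for
`½ + h > 0`, `L(½ + h + it, χ) ≠ 0` for `|t| ≥ 1`; by `abs_re_logDeriv_dirichletXi_sub_le`, the constant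
`½ log(N/2π)` and the error `(σ + κ + 4)/(2|t|)` being absorbed into `(η/2) log|t|`.
[cite: Lagarias2005, Theorem 5.2, proof (arXiv p. 10 L143–151) with (4.5) p. 9] -/
theorem abs_velocity_sub_half_log_le (h1 : χ ≠ 1) {h : ℝ} (hx : 0 < 1 / 2 + h) (θ : ℝ)
    (hLne : ∀ t : ℝ, 1 ≤ |t| → χ.LFunction (1 / 2 + h + t * I) ≠ 0)
    (hR : ∀ η : ℝ, 0 < η → ∃ T₀ : ℝ, ∀ t : ℝ, T₀ ≤ |t| →
      ‖deriv χ.LFunction (1 / 2 + h + t * I) / χ.LFunction (1 / 2 + h + t * I)‖ ≤ η * Real.log |t|) :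
    ∀ η : ℝ, 0 < η → ∃ T₀ : ℝ, ∀ t : ℝ, T₀ ≤ |t| →
      |(logDeriv (diffXiCharErot χ h θ) (1 / 2 + t * I)).re - 1 / 2 * Real.log (|t|)| ≤ η * Real.log |t| := by
  intro η hη
  have hπ := Real.pi_pos
  have hN : (0 : ℝ) < N := Nat.cast_pos.2 (NeZero.pos N)
  set x : ℝ := 1 / 2 + h with hxdef
  set K : ℝ := (x + charParity χ + 4) / 2 + |1 / 2 * Real.log ((N : ℝ) / (2 * π))| with hK
  have hK0 : 0 ≤ K := by rw [hK]; positivity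
  obtain ⟨T₀, hT₀⟩ := hR (η / 2) (half_pos hη)
  set M : ℝ := Real.exp (K / (η / 2)) with hM
  refine ⟨max (max T₀ 1) M, fun t ht ↦ ?_⟩
  have ht1 : 1 ≤ |t| := le_trans (le_trans (le_max_right _ _) (le_max_left _ _)) ht
  have htT₀ : T₀ ≤ |t| := le_trans (le_trans (le_max_left _ _) (le_max_left _ _)) ht
  have htM : M ≤ |t| := le_trans (le_max_right _ _) ht
  have htpos : 0 < |t| := by linarith
  have hlogt0 : 0 ≤ Real.log |t| := Real.log_nonneg ht1
  have hlogt : K / (η / 2) ≤ Real.log |t| := by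
    rw [← Real.log_exp (K / (η / 2))]
    exact Real.log_le_log (Real.exp_pos _) htM
  have hbig : K ≤ Real.log |t| * (η / 2) := (div_le_iff₀ (half_pos hη)).1 hlogt
  -- the point `s = ½ + h + it`
  set s : ℂ := 1 / 2 + h + t * I with hs
  have es : (1 / 2 : ℂ) + t * I + h = s := by rw [hs]; ring
  have hsre : s.re = x := by simp [hs, hxdef]
  have hsim : s.im = t := by simp [hs]
  have hs0 : 0 < s.re := by rw [hsre]; exact hx
  have hsim1 : 1 ≤ |s.im| := by rw [hsim]; exact ht1
  have hLs : χ.LFunction s ≠ 0 := hLne t ht1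
  have hE := abs_re_logDeriv_dirichletXi_sub_le h1 hs0 hsim1 hLs
  rw [hsre, hsim] at hE
  -- `log(N|t|/2π) = log|t| + log(N/2π)`
  have hsplit : Real.log ((N : ℝ) * |t| / (2 * π)) = Real.log |t| + Real.log ((N : ℝ) / (2 * π)) := by
    rw [show (N : ℝ) * |t| / (2 * π) = |t| * ((N : ℝ) / (2 * π)) by ring,
      Real.log_mul htpos.ne' (by positivity)]
  rw [hsplit] at hE
  rw [logDeriv_diffXiCharErot, es]
  -- the `L'/L` term
  have hZ : |(deriv χ.LFunction s / χ.LFunction s).re| ≤ η / 2 * Real.log |t| :=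
    (Complex.abs_re_le_norm _).trans (by rw [hs]; exact hT₀ t htT₀)
  have hKt : (x + charParity χ + 4) / (2 * |t|) ≤ (x + charParity χ + 4) / 2 := by
    rw [div_le_div_iff₀ (by positivity) (by norm_num)]
    have : 0 ≤ x + charParity χ + 4 := by positivity
    nlinarith
  have hc := abs_le.1 (show |1 / 2 * Real.log ((N : ℝ) / (2 * π))| ≤ |1 / 2 * Real.log ((N : ℝ) / (2 * π))|
    from le_rfl)
  obtain ⟨hE1, hE2⟩ := abs_le.1 hE
  obtain ⟨hZ1, hZ2⟩ := abs_le.1 hZ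
  obtain ⟨hc1, hc2⟩ := hc
  rw [abs_le]
  constructor <;> linarith

end Velocity

/-! ## F. Theorem 5.2: assembly -/

section Assembly

variable {N : ℕ} [NeZero N] {χ : DirichletCharacter ℂ N}

/-- **Theorem 5.2 for `h` from the data on the line `Re s = ½ + h`** (both parts): if `E_{h,θ}(·, χ)`
satisfies the Hermite–Biehler inequality `|E(1 − s̄)| < |E(s)|` on `Re s > ½` and does not vanish on the
critical line (so that the phase velocity `Re ξ′/ξ(½ + h + it, χ)` is positive, Hopf's lemma
`re_logDeriv_pos_of_critHB`), `L(½ + h + it, χ) ≠ 0` for `|t| ≥ 1`, and `L′/L = o(log|t|)` on that line,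
then the `k` consecutive normalised zero spacings of `A_{h,θ}(·, χ)`, `B_{h,θ}(·, χ)` have the trivial
limiting distribution. [cite: Lagarias2005, Theorem 5.2, proof (arXiv p. 10 L143–151)] -/
theorem hasTrivialSpacingDistribution_diffXiChar_of_line (h1 : χ ≠ 1) {h : ℝ} (hx : 0 < 1 / 2 + h)
    {θ : ℝ} (hHB : ∀ s : ℂ, 1 / 2 < s.re → ‖diffXiCharErot χ h θ (1 - conj s)‖ < ‖diffXiCharErot χ h θ s‖)
    (hne : ∀ t : ℝ, diffXiCharErot χ h θ (1 / 2 + t * I) ≠ 0)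
    (hLne : ∀ t : ℝ, 1 ≤ |t| → χ.LFunction (1 / 2 + h + t * I) ≠ 0)
    (hR : ∀ η : ℝ, 0 < η → ∃ T₀ : ℝ, ∀ t : ℝ, T₀ ≤ |t| →
      ‖deriv χ.LFunction (1 / 2 + h + t * I) / χ.LFunction (1 / 2 + h + t * I)‖ ≤ η * Real.log |t|)
    (k : ℕ) :
    HasTrivialSpacingDistribution (diffXiCharArot χ h θ) k ∧
      HasTrivialSpacingDistribution (diffXiCharBrot χ h θ) k := by
  have hEd : Differentiable ℂ (diffXiCharErot χ h θ) := differentiable_diffXiCharErot h1 h θ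
  have hpos : ∀ t : ℝ, 0 < (logDeriv (diffXiCharErot χ h θ) (1 / 2 + t * I)).re := fun t ↦
    re_logDeriv_pos_of_critHB hEd hHB (hne t)
  exact hasTrivialSpacingDistribution_critParts_of_velocity hEd hpos
    (abs_velocity_sub_half_log_le h1 hx θ hLne hR) k

/-- **Theorem 5.2 (1) for `h ≥ ½` from an `o(log|t|)` bound for `L′/L` on `Re s = ½ + h`** (every real
`θ`): Hermite–Biehler from Lemma 5.1 (1) (`diffXiCharErot_critHB`), non-vanishing on the line
(`diffXiCharErot_critLine_ne_zero`), `L ≠ 0` on `Re s ≥ 1`.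
[cite: Lagarias2005, Theorem 5.2 (1), proof (arXiv p. 10 L143–151)] -/
theorem hasTrivialSpacingDistribution_diffXiChar_of_half_le (hχ : χ.IsPrimitive) (h1 : χ ≠ 1) {h : ℝ}
    (hh : 1 / 2 ≤ h)
    (hR : ∀ η : ℝ, 0 < η → ∃ T₀ : ℝ, ∀ t : ℝ, T₀ ≤ |t| →
      ‖deriv χ.LFunction (1 / 2 + h + t * I) / χ.LFunction (1 / 2 + h + t * I)‖ ≤ η * Real.log |t|)
    (θ : ℝ) (k : ℕ) :
    HasTrivialSpacingDistribution (diffXiCharArot χ h θ) k ∧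
      HasTrivialSpacingDistribution (diffXiCharBrot χ h θ) k := by
  refine hasTrivialSpacingDistribution_diffXiChar_of_line h1 (by linarith) (diffXiCharErot_critHB hχ h1 hh θ)
    (diffXiCharErot_critLine_ne_zero hχ h1 hh θ) (fun t _ ↦ ?_) hR k
  exact DirichletCharacter.LFunction_ne_zero_of_one_le_re χ (Or.inl h1) (by simp; linarith)

/-- `−(A)` bookkeeping: the critical zero ordinates of `−F` and `F` agree. [folklore] -/
private theorem critZeroOrdinates_neg (F : ℂ → ℂ) : critZeroOrdinates (-F) = critZeroOrdinates F := by
  ext t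
  simp only [mem_critZeroOrdinates, Pi.neg_apply, neg_eq_zero]

/-- **The reduction `h ↦ −h`**: Theorem 5.2 for `(h, θ)` follows from Theorem 5.2 for `(|h|, θ′)` for
all `θ′`, since `A_{−h,θ}(·, χ) = A_{h,θ′}(·, χ)` and `B_{−h,θ}(·, χ) = −B_{h,θ′}(·, χ)` with
`θ′ = −θ − arg ε(χ)` (`diffXiCharArot_neg`, `diffXiCharBrot_neg`), and `−B` has the same critical zero
ordinates as `B`. [cite: Lagarias2005, Theorem 5.2, proof (arXiv p. 10) with §2 p.4 (A_{−h} = A_h)] -/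
theorem hasTrivialSpacingDistribution_diffXiChar_of_abs (hχ : χ.IsPrimitive) (h1 : χ ≠ 1) {h : ℝ}
    (habs : ∀ θ' : ℝ, ∀ k : ℕ, HasTrivialSpacingDistribution (diffXiCharArot χ |h| θ') k ∧
      HasTrivialSpacingDistribution (diffXiCharBrot χ |h| θ') k)
    (θ : ℝ) (k : ℕ) :
    HasTrivialSpacingDistribution (diffXiCharArot χ h θ) k ∧
      HasTrivialSpacingDistribution (diffXiCharBrot χ h θ) k := by
  rcases le_or_gt 0 h with h0 | h0
  · rw [abs_of_nonneg h0] at habs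
    exact habs θ k
  · rw [abs_of_neg h0] at habs
    obtain ⟨hA, hB⟩ := habs (-θ - Complex.arg χ.rootNumber) k
    have eA : diffXiCharArot χ h θ = diffXiCharArot χ (-h) (-θ - Complex.arg χ.rootNumber) := by
      rw [← diffXiCharArot_neg hχ h1 (-h) θ, neg_neg]
    have eB : critZeroOrdinates (diffXiCharBrot χ h θ) =
        critZeroOrdinates (diffXiCharBrot χ (-h) (-θ - Complex.arg χ.rootNumber)) := by
      rw [show diffXiCharBrot χ h θ = diffXiCharBrot χ (-(-h)) θ by rw [neg_neg],
        diffXiCharBrot_neg hχ h1 (-h) θ, critZeroOrdinates_neg]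
    rw [eA]
    exact ⟨hA, (hasTrivialSpacingDistribution_congr eB k).2 hB⟩

/-- **Lagarias 2005, Theorem 5.2 (1) on `|h| > ½` — UNCONDITIONAL** (RH-free; every real `θ`, every
`k`): for a primitive non-principal `χ` and `|h| > ½`, the `k` consecutive normalised zero spacings of
`A_{h,θ}(·, χ)` and of `B_{h,θ}(·, χ)` have the trivial limiting distribution `δ_{(1,…,1)}`. "The analogue
of part (1), that `R_h(T) = O(1)`, follows from the absolute convergence of the Dirichlet series for
`−L′/L(s, χ)` in `Re(s) > 1`" — the tree's `‖L′/L(s, χ)‖ ≤ 1/(σ − 1) + K₀`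
(`DirichletZFR.exists_norm_logDeriv_le`). [cite: Lagarias2005, Theorem 5.2 (1) (arXiv p. 10 L124–133, proof L143–151)] -/
theorem hasTrivialSpacingDistribution_diffXiChar_of_half_lt (hχ : χ.IsPrimitive) (h1 : χ ≠ 1) {h : ℝ}
    (hh : 1 / 2 < |h|) (θ : ℝ) (k : ℕ) :
    HasTrivialSpacingDistribution (diffXiCharArot χ h θ) k ∧
      HasTrivialSpacingDistribution (diffXiCharBrot χ h θ) k := by
  refine hasTrivialSpacingDistribution_diffXiChar_of_abs hχ h1 (fun θ' k' ↦ ?_) θ k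
  refine hasTrivialSpacingDistribution_diffXiChar_of_half_le hχ h1 hh.le (fun η hη ↦ ?_) θ' k'
  -- Lemma 4.1 (1) for `χ`: `‖L'/L(σ + it, χ)‖ ≤ C` on `σ = ½ + |h| > 1`
  obtain ⟨K₀, hK₀, -, hK⟩ := DirichletZFR.exists_norm_logDeriv_le
  set C : ℝ := 1 / (min (1 / 2 + |h|) 2 - 1) + K₀ with hC
  have hmin : 0 < min (1 / 2 + |h|) 2 - 1 := by
    rw [sub_pos, lt_min_iff]; constructor <;> linarith
  have hC0 : 0 ≤ C := by rw [hC]; positivity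
  refine ⟨max 1 (Real.exp (C / η)), fun t ht ↦ ?_⟩
  have ht1 : 1 ≤ |t| := le_trans (le_max_left _ _) ht
  have hlog : C / η ≤ Real.log |t| := by
    rw [← Real.log_exp (C / η)]
    exact Real.log_le_log (Real.exp_pos _) (le_trans (le_max_right _ _) ht)
  have hCle : C ≤ η * Real.log |t| := by
    have := (div_le_iff₀ hη).1 hlog; linarith
  have hre : ((1 / 2 : ℂ) + (|h| : ℝ) + t * I).re = 1 / 2 + |h| := by simp
  have hb := hK N χ ((1 / 2 : ℂ) + (|h| : ℝ) + t * I) (by rw [hre]; linarith)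
  rw [hre] at hb
  exact hb.trans hCle

end Assembly

/-! ## G. The endpoint `|h| = ½`: the velocity estimate in INTEGRAL form

At `h = ½` the line is `Re s = 1`, where the tree bounds `L′/L(1 + it, χ)` only in the mean
(`∫_{−T}^{T} ‖L′/L(1 + it, χ)‖ dt = O(T)`, cell rh-crit/dbl row R14-S), not pointwise by `o(log t)`.
The lemmas below turn such a mean bound into
`∫_{−T}^{T} |v(t) − ½ log|t|| dt = o(T log T)` for the phase velocity `v` of `E_{½,θ}(·, χ)`, the
hypothesis of the averaged phase-lattice lemma of `LagariasSpacingAveragedPhaseProofs.lean`. -/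

section Endpoint

variable {N : ℕ} [NeZero N] {χ : DirichletCharacter ℂ N}

/-- **Pointwise form of the velocity estimate with the `L′/L` term kept**: for `½ + h > 0`, `|t| ≥ 1`,
`L(½ + h + it, χ) ≠ 0`:
`|Re E_{h,θ}′/E_{h,θ}(½ + it, χ) − ½ log|t|| ≤ K_h + ‖L′/L(½ + h + it, χ)‖` with the constant
`K_h = (½ + h + κ + 4)/2 + |½ log(N/2π)|`. [cite: Lagarias2005, Theorem 5.2, proof (arXiv p. 10 L143–151) with (4.5) p. 9] -/
theorem abs_velocity_sub_half_log_le_add (h1 : χ ≠ 1) {h : ℝ} (hx : 0 < 1 / 2 + h) (θ : ℝ) {t : ℝ}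
    (ht : 1 ≤ |t|) (hL : χ.LFunction (1 / 2 + h + t * I) ≠ 0) :
    |(logDeriv (diffXiCharErot χ h θ) (1 / 2 + t * I)).re - 1 / 2 * Real.log (|t|)| ≤
      ((1 / 2 + h + charParity χ + 4) / 2 + |1 / 2 * Real.log ((N : ℝ) / (2 * π))|) +
        ‖deriv χ.LFunction (1 / 2 + h + t * I) / χ.LFunction (1 / 2 + h + t * I)‖ := by
  have hπ := Real.pi_pos
  have hN : (0 : ℝ) < N := Nat.cast_pos.2 (NeZero.pos N)
  have htpos : 0 < |t| := by linarith
  set s : ℂ := 1 / 2 + h + t * I with hs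
  have es : (1 / 2 : ℂ) + t * I + h = s := by rw [hs]; ring
  have hsre : s.re = 1 / 2 + h := by simp [hs]
  have hsim : s.im = t := by simp [hs]
  have hs0 : 0 < s.re := by rw [hsre]; exact hx
  have hsim1 : 1 ≤ |s.im| := by rw [hsim]; exact ht
  have hE := abs_re_logDeriv_dirichletXi_sub_le h1 hs0 hsim1 hL
  rw [hsre, hsim] at hE
  have hsplit : Real.log ((N : ℝ) * |t| / (2 * π)) = Real.log |t| + Real.log ((N : ℝ) / (2 * π)) := by
    rw [show (N : ℝ) * |t| / (2 * π) = |t| * ((N : ℝ) / (2 * π)) by ring,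
      Real.log_mul htpos.ne' (by positivity)]
  rw [hsplit] at hE
  rw [logDeriv_diffXiCharErot, es]
  have hZ : |(deriv χ.LFunction s / χ.LFunction s).re| ≤ ‖deriv χ.LFunction s / χ.LFunction s‖ :=
    Complex.abs_re_le_norm _
  have hKt : (1 / 2 + h + charParity χ + 4) / (2 * |t|) ≤ (1 / 2 + h + charParity χ + 4) / 2 := by
    rw [div_le_div_iff₀ (by positivity) (by norm_num)]
    have : 0 ≤ 1 / 2 + h + (charParity χ : ℝ) + 4 := by positivity
    nlinarith
  have hc := le_abs_self (1 / 2 * Real.log ((N : ℝ) / (2 * π)))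
  have hc' := neg_abs_le (1 / 2 * Real.log ((N : ℝ) / (2 * π)))
  obtain ⟨hE1, hE2⟩ := abs_le.1 hE
  obtain ⟨hZ1, hZ2⟩ := abs_le.1 hZ
  rw [abs_le]
  constructor <;> linarith

/-- `E_{½,θ}(½ + it, χ) ≠ 0` (the point `1 + it` lies outside the open critical strip).
[cite: Lagarias2005, Theorem 5.1 (1), proof (arXiv p. 10)] -/
theorem diffXiCharErot_half_critLine_ne_zero (hχ : χ.IsPrimitive) (h1 : χ ≠ 1) (θ t : ℝ) :
    diffXiCharErot χ (1 / 2) θ (1 / 2 + t * I) ≠ 0 :=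
  diffXiCharErot_critLine_ne_zero hχ h1 le_rfl θ t

/-- **The velocity estimate at the endpoint `h = ½`, in the mean.** If
`t ↦ L′/L(1 + it, χ)` is continuous and `∫_{−T}^{T} ‖L′/L(1 + it, χ)‖ dt ≤ C·T` for `T ≥ 1`, then the
phase velocity `v` of `E_{½,θ}(·, χ)` satisfies `∫_{−T}^{T} |v(t) − ½ log|t|| dt ≤ C′·T` for `T ≥ 1`
(`|v − ½ log|t|| ≤ K + ‖L′/L‖` for `|t| ≥ 1` by `abs_velocity_sub_half_log_le_add`; on `[−1, 1]` the
continuous `v` is bounded and `∫_{−1}^{1} |log|t|| dt = 2`).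
[cite: Lagarias2005, Theorem 5.2, proof (arXiv p. 10 L143–175)] -/
theorem exists_integral_abs_velocity_sub_le (hχ : χ.IsPrimitive) (h1 : χ ≠ 1) (θ : ℝ)
    (hcont : Continuous fun t : ℝ ↦ deriv χ.LFunction (1 + t * I) / χ.LFunction (1 + t * I))
    {C : ℝ} (hC : ∀ T : ℝ, 1 ≤ T →
      (∫ t in (-T)..T, ‖deriv χ.LFunction (1 + t * I) / χ.LFunction (1 + t * I)‖) ≤ C * T) :
    ∃ C' : ℝ, ∀ T : ℝ, 1 ≤ T →
      (∫ t in (-T)..T, |(logDeriv (diffXiCharErot χ (1 / 2) θ) (1 / 2 + t * I)).re - 1 / 2 * Real.log (|t|)|)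
        ≤ C' * T := by
  have hπ := Real.pi_pos
  -- the velocity and its majorants
  set v : ℝ → ℝ := fun t ↦ (logDeriv (diffXiCharErot χ (1 / 2) θ) (1 / 2 + t * I)).re with hv
  set f : ℝ → ℝ := fun t ↦ |v t - 1 / 2 * Real.log (|t|)| with hf
  set g : ℝ → ℝ := fun t ↦ ‖deriv χ.LFunction (1 + t * I) / χ.LFunction (1 + t * I)‖ with hg
  set K : ℝ := (1 / 2 + (1 / 2 : ℝ) + charParity χ + 4) / 2 + |1 / 2 * Real.log ((N : ℝ) / (2 * π))| with hK
  have hK0 : 0 ≤ K := by rw [hK]; positivity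
  have hvc : Continuous v :=
    continuous_re_logDeriv_critLine (differentiable_diffXiCharErot h1 _ _)
      (diffXiCharErot_half_critLine_ne_zero hχ h1 θ)
  -- `v` is bounded on `[−1, 1]`
  obtain ⟨M, hM⟩ := (isCompact_Icc (a := (-1 : ℝ)) (b := 1)).exists_bound_of_continuousOn hvc.continuousOn
  have hM0 : 0 ≤ M := le_trans (norm_nonneg _) (hM 0 (by norm_num))
  -- integrability
  have hfi : ∀ a b : ℝ, IntervalIntegrable f volume a b := by
    intro a b
    have hli : IntervalIntegrable (fun t : ℝ ↦ Real.log (|t|)) volume a b := by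
      simp_rw [Real.log_abs]
      exact intervalIntegral.intervalIntegrable_log'
    have h1' : IntervalIntegrable (fun t ↦ v t - 1 / 2 * Real.log (|t|)) volume a b :=
      (hvc.intervalIntegrable a b).sub (hli.const_mul (1 / 2))
    exact h1'.abs
  have hgc : Continuous g := hcont.norm
  have hgi : ∀ a b : ℝ, IntervalIntegrable g volume a b := fun a b ↦ hgc.intervalIntegrable a b
  have hKg : ∀ a b : ℝ, IntervalIntegrable (fun t ↦ K + g t) volume a b := fun a b ↦
    intervalIntegrable_const.add (hgi a b)
  -- pointwise: `f ≤ K + g` for `|t| ≥ 1`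
  have hpt : ∀ t : ℝ, 1 ≤ |t| → f t ≤ K + g t := by
    intro t ht
    have hL : χ.LFunction (1 / 2 + (1 / 2 : ℝ) + t * I) ≠ 0 :=
      DirichletCharacter.LFunction_ne_zero_of_one_le_re χ (Or.inl h1) (by simp; norm_num)
    have := abs_velocity_sub_half_log_le_add h1 (h := 1 / 2) (by norm_num) θ ht hL
    have e : (1 / 2 : ℂ) + ((1 / 2 : ℝ) : ℂ) + t * I = 1 + t * I := by push_cast; ring
    rw [e] at this
    simpa only [hf, hv, hg, hK] using this
  -- pointwise: `f ≤ M − ½ log t` on `[−1, 1]`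
  have hmid : ∀ t ∈ Icc (-1 : ℝ) 1, f t ≤ M - 1 / 2 * Real.log t := by
    intro t htI
    have habs1 : |t| ≤ 1 := abs_le.2 ⟨htI.1, htI.2⟩
    have hlog0 : Real.log (|t|) ≤ 0 := Real.log_nonpos (abs_nonneg t) habs1
    have hvM : |v t| ≤ M := by simpa [Real.norm_eq_abs] using hM t htI
    have : f t ≤ |v t| + |1 / 2 * Real.log (|t|)| := by
      simp only [hf]; exact abs_sub _ _
    rw [abs_of_nonpos (by linarith : 1 / 2 * Real.log (|t|) ≤ 0), Real.log_abs] at this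
    linarith
  refine ⟨2 * K + |C| + 2 * M + 1, fun T hT ↦ ?_⟩
  have hT0 : 0 ≤ T := by linarith
  -- split `[−T, T] = [−T, −1] ∪ [−1, 1] ∪ [1, T]`
  have hsplit : (∫ t in (-T)..T, f t) =
      (∫ t in (-T)..(-1), f t) + (∫ t in (-1:ℝ)..1, f t) + ∫ t in (1:ℝ)..T, f t := by
    rw [intervalIntegral.integral_add_adjacent_intervals (hfi _ _) (hfi _ _),
      intervalIntegral.integral_add_adjacent_intervals (hfi _ _) (hfi _ _)]
  -- the three pieces
  have hright : (∫ t in (1:ℝ)..T, f t) ≤ K * (T - 1) + ∫ t in (1:ℝ)..T, g t := by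
    have hm : (∫ t in (1:ℝ)..T, f t) ≤ ∫ t in (1:ℝ)..T, (K + g t) :=
      intervalIntegral.integral_mono_on hT (hfi _ _) (hKg _ _) fun t htI ↦
        hpt t (by rw [abs_of_pos (by linarith [htI.1])]; exact htI.1)
    rw [intervalIntegral.integral_add intervalIntegrable_const (hgi _ _), intervalIntegral.integral_const,
      smul_eq_mul] at hm
    linarith
  have hleft : (∫ t in (-T)..(-1), f t) ≤ K * (T - 1) + ∫ t in (-T)..(-1), g t := by
    have hle : -T ≤ -1 := by linarith
    have hm : (∫ t in (-T)..(-1), f t) ≤ ∫ t in (-T)..(-1), (K + g t) :=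
      intervalIntegral.integral_mono_on hle (hfi _ _) (hKg _ _) fun t htI ↦
        hpt t (by rw [abs_of_neg (by linarith [htI.2])]; linarith [htI.2])
    rw [intervalIntegral.integral_add intervalIntegrable_const (hgi _ _), intervalIntegral.integral_const,
      smul_eq_mul] at hm
    linarith
  have hmidI : (∫ t in (-1:ℝ)..1, f t) ≤ 2 * M + 1 := by
    have hli : IntervalIntegrable (fun t ↦ M - 1 / 2 * Real.log t) volume (-1) 1 :=
      intervalIntegrable_const.sub (intervalIntegral.intervalIntegrable_log'.const_mul (1 / 2))
    have hm : (∫ t in (-1:ℝ)..1, f t) ≤ ∫ t in (-1:ℝ)..1, (M - 1 / 2 * Real.log t) :=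
      intervalIntegral.integral_mono_on (by norm_num) (hfi _ _) hli hmid
    rw [intervalIntegral.integral_sub intervalIntegrable_const
        (intervalIntegral.intervalIntegrable_log'.const_mul (1 / 2)),
      intervalIntegral.integral_const, intervalIntegral.integral_const_mul, integral_log, smul_eq_mul] at hm
    simp only [Real.log_one, Real.log_neg_eq_log, mul_zero, sub_zero] at hm
    linarith
  -- the two outer `g`-pieces are dominated by the full integral
  have hgsum : (∫ t in (-T)..(-1), g t) + (∫ t in (1:ℝ)..T, g t) ≤ |C| * T := by
    have hfull : (∫ t in (-T)..T, g t) =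
        (∫ t in (-T)..(-1), g t) + (∫ t in (-1:ℝ)..1, g t) + ∫ t in (1:ℝ)..T, g t := by
      rw [intervalIntegral.integral_add_adjacent_intervals (hgi _ _) (hgi _ _),
        intervalIntegral.integral_add_adjacent_intervals (hgi _ _) (hgi _ _)]
    have hmid0 : 0 ≤ ∫ t in (-1:ℝ)..1, g t :=
      intervalIntegral.integral_nonneg (by norm_num) fun t _ ↦ norm_nonneg _
    have hCT : (∫ t in (-T)..T, g t) ≤ |C| * T :=
      (hC T hT).trans (mul_le_mul_of_nonneg_right (le_abs_self C) hT0)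
    linarith
  rw [hsplit]
  nlinarith [hK0, hM0, abs_nonneg C]

/-- **`o(T log T)` form**: under the same mean hypothesis, for every `η > 0` and all large `T`,
`∫_{−T}^{T} |v(t) − ½ log|t|| dt ≤ η·T log T` — the hypothesis `hint` of the averaged phase-lattice
lemma. [cite: Lagarias2005, Theorem 5.2, proof (arXiv p. 10 L143–175)] -/
theorem integral_abs_velocity_sub_le_mul_log (hχ : χ.IsPrimitive) (h1 : χ ≠ 1) (θ : ℝ)
    (hcont : Continuous fun t : ℝ ↦ deriv χ.LFunction (1 + t * I) / χ.LFunction (1 + t * I))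
    {C : ℝ} (hC : ∀ T : ℝ, 1 ≤ T →
      (∫ t in (-T)..T, ‖deriv χ.LFunction (1 + t * I) / χ.LFunction (1 + t * I)‖) ≤ C * T) :
    ∀ η : ℝ, 0 < η → ∃ T₀ : ℝ, ∀ T : ℝ, T₀ ≤ T →
      (∫ t in (-T)..T, |(logDeriv (diffXiCharErot χ (1 / 2) θ) (1 / 2 + t * I)).re - 1 / 2 * Real.log (|t|)|)
        ≤ η * (T * Real.log T) := by
  obtain ⟨C', hC'⟩ := exists_integral_abs_velocity_sub_le hχ h1 θ hcont hC
  intro η hη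
  refine ⟨max 1 (Real.exp (|C'| / η)), fun T hT ↦ ?_⟩
  have hT1 : 1 ≤ T := le_trans (le_max_left _ _) hT
  have hT0 : 0 ≤ T := by linarith
  have hlog : |C'| / η ≤ Real.log T := by
    rw [← Real.log_exp (|C'| / η)]
    exact Real.log_le_log (Real.exp_pos _) (le_trans (le_max_right _ _) hT)
  have h1' : |C'| ≤ η * Real.log T := by
    have := (div_le_iff₀ hη).1 hlog; linarith
  calc (∫ t in (-T)..T, |(logDeriv (diffXiCharErot χ (1 / 2) θ) (1 / 2 + t * I)).re - 1 / 2 * Real.log (|t|)|)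
      ≤ C' * T := hC' T hT1
    _ ≤ |C'| * T := mul_le_mul_of_nonneg_right (le_abs_self C') hT0
    _ ≤ η * Real.log T * T := mul_le_mul_of_nonneg_right h1' hT0
    _ = η * (T * Real.log T) := by ring

/-- **The endpoint velocity estimate `∫_{−T}^{T} |v(t) − ½ log|t|| dt = o(T log T)` for
`E_{½,θ}(·, χ)`, UNCONDITIONALLY** (`χ` primitive non-principal, every real `θ`): the mean hypothesis
of the previous lemma is the tree's mean-value bound `∫_{−T}^{T} ‖L′/L(1 + it, χ)‖ dt ≤ C·T`
(`DirichletLogDerivMeanValue.exists_integral_norm_logDeriv_one_le`, from the sharp mean-value theorem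
for Dirichlet series) and the continuity of `L′/L` on `Re s = 1`
(`DirichletLogDerivMeanValue.continuous_logDeriv_LFunction_vertical`). This replaces, in the mean, the
pointwise `|L′/L(1 + iT, χ)| = O(log|T|/log log|T|)` that the printed proof takes from [IK04].
[cite: Lagarias2005, Theorem 5.2, proof (arXiv p. 10 L152–175)] -/
theorem integral_abs_velocity_half_sub_le_mul_log (hχ : χ.IsPrimitive) (h1 : χ ≠ 1) (θ : ℝ) :
    ∀ η : ℝ, 0 < η → ∃ T₀ : ℝ, ∀ T : ℝ, T₀ ≤ T →
      (∫ t in (-T)..T, |(logDeriv (diffXiCharErot χ (1 / 2) θ) (1 / 2 + t * I)).re - 1 / 2 * Real.log (|t|)|)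
        ≤ η * (T * Real.log T) := by
  obtain ⟨C, hC⟩ := DirichletLogDerivMeanValue.exists_integral_norm_logDeriv_one_le χ h1
  have hcont := DirichletLogDerivMeanValue.continuous_logDeriv_LFunction_vertical χ h1 (σ := 1) le_rfl
  simp only [Complex.ofReal_one] at hcont
  exact integral_abs_velocity_sub_le_mul_log hχ h1 θ hcont hC

end Endpoint

end Lagarias2005CharSpacing

open Lagarias2005CharSpacing

/-- **Lagarias 2005, Theorem 5.2 (1), BY NAME, from the POINTWISE endpoint input** (RH-free; the
printed road). The named fact `lagarias2005_thm_5_2_1` (`|h| ≥ ½`) follows from the `χ`-analogue of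
Lemma 4.1 (2) taken as an explicit HYPOTHESIS BINDER — for every primitive non-principal `χ`:
`L′/L(1 + it, χ) = o(log|t|)` (Lagarias: "`|L′/L(1 + iT, χ)| = O(log|T|/log log|T|)` … deducible from
[IK04]"; classically Littlewood–Weyl for fixed modulus; NOT in the tree, which has only `O(log)`-type
pointwise bounds for `L′/L` near `σ = 1`) — used only at the endpoint `|h| = ½`; the open range `|h| > ½`
is `hasTrivialSpacingDistribution_diffXiChar_of_half_lt`, unconditionally. No fact is introduced. The
UNCONDITIONAL discharge is `lagarias2005_thm_5_2_1_holds` (Part J, averaged endpoint input).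
[cite: Lagarias2005, Theorem 5.2 (1) (arXiv p. 10 L124–133; proof L143–175)] -/
theorem lagarias2005_thm_5_2_1_of_logDeriv_one
    (hL₁ : ∀ (N : ℕ) [NeZero N] (χ : DirichletCharacter ℂ N), χ.IsPrimitive → χ ≠ 1 →
      ∀ η : ℝ, 0 < η → ∃ T₀ : ℝ, ∀ t : ℝ, T₀ ≤ |t| →
        ‖deriv χ.LFunction (1 + t * I) / χ.LFunction (1 + t * I)‖ ≤ η * Real.log |t|) :
    lagarias2005_thm_5_2_1 := by
  intro N _ χ hχ h1 k _ h θ hh _ _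
  rcases hh.lt_or_eq with hlt | heq
  · exact hasTrivialSpacingDistribution_diffXiChar_of_half_lt hχ h1 hlt θ k
  · refine hasTrivialSpacingDistribution_diffXiChar_of_abs hχ h1 (fun θ' k' ↦ ?_) θ k
    refine hasTrivialSpacingDistribution_diffXiChar_of_half_le hχ h1 (le_of_eq heq) (fun η hη ↦ ?_) θ' k'
    obtain ⟨T₀, hT₀⟩ := hL₁ N χ hχ h1 η hη
    refine ⟨T₀, fun t ht ↦ ?_⟩
    have e : (1 / 2 : ℂ) + (|h| : ℝ) + t * I = 1 + t * I := by
      rw [← heq]; push_cast; ring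
    rw [e]
    exact hT₀ t ht

/-- **Lagarias 2005, Theorem 5.2 (2), BY NAME, modulo the GRH-side input** (GRH(χ)-CONSEQUENCE; the
binder `χ.RiemannHypothesis` of the statement is kept, never dropped and never asserted). The named fact
`lagarias2005_thm_5_2_2` (`0 < |h| < ½` under the Riemann hypothesis for `L(s, χ)`) follows from the
`χ`-analogue of Lemma 4.1 (3) taken as an explicit HYPOTHESIS BINDER — under GRH(χ), for `0 < h < ½`,
`L′/L(½ + h + it, χ) = o(log|t|)` (Lagarias: "`O((log|T|)^{2−2σ})` … from a result of Iwaniec and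
Kowalski [IK04]"; NOT in the tree). Positivity of the velocity under GRH is Lemma 5.1 (2)
(`diffXiCharErot_critHB_of_rh`), `L ≠ 0` on `Re s > ½` is `Lagarias2005Char.LFunction_ne_zero_of_rh`.
No fact is introduced. [cite: Lagarias2005, Theorem 5.2 (2) (arXiv p. 10 L134–141; proof L152–165)] -/
theorem lagarias2005_thm_5_2_2_of_logDeriv
    (hL₃ : ∀ (N : ℕ) [NeZero N] (χ : DirichletCharacter ℂ N), χ.IsPrimitive → χ ≠ 1 → χ.RiemannHypothesis →
      ∀ h : ℝ, 0 < h → h < 1 / 2 → ∀ η : ℝ, 0 < η → ∃ T₀ : ℝ, ∀ t : ℝ, T₀ ≤ |t| →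
        ‖deriv χ.LFunction (1 / 2 + h + t * I) / χ.LFunction (1 / 2 + h + t * I)‖ ≤ η * Real.log |t|) :
    lagarias2005_thm_5_2_2 := by
  intro N _ χ hχ h1 hG k _ h θ hh0 hh _ _
  refine hasTrivialSpacingDistribution_diffXiChar_of_abs hχ h1 (fun θ' k' ↦ ?_) θ k
  have hx : 0 < 1 / 2 + |h| := by positivity
  refine hasTrivialSpacingDistribution_diffXiChar_of_line h1 hx (diffXiCharErot_critHB_of_rh hχ h1 hG hh0 θ')
    (diffXiCharErot_critLine_ne_zero_of_rh hχ h1 hG hh0 θ') (fun t _ ↦ ?_) (hL₃ N χ hχ h1 hG |h| hh0 hh) k'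
  exact Lagarias2005Char.LFunction_ne_zero_of_rh h1 hG (by
    simp only [Complex.add_re, Complex.div_ofNat_re, Complex.one_re, Complex.mul_re, Complex.ofReal_re,
      Complex.I_re, Complex.ofReal_im, Complex.I_im, mul_zero, mul_one, sub_self, add_zero]
    linarith)

/-! ## I. Theorem 5.2 (2): the GRH-side input from the tree (Littlewood's log-power bound) -/

/-- **Lagarias 2005, Theorem 5.2 (2)** — discharge of the named fact `lagarias2005_thm_5_2_2`
(GRH(χ)-CONSEQUENCE: the binder `χ.RiemannHypothesis` is the statement's own hypothesis — kept, never
dropped, never asserted). The `χ`-analogue of Lemma 4.1 (3) — under GRH(χ), for fixed `½ < σ < 1`,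
`‖L′/L(σ + it, χ)‖ ≤ C (log|t|)^{2−2σ}` for `|t| ≥ 3` (Lagarias: "where `σ = ½ + |h|` … from a result
of Iwaniec and Kowalski [IK04]"; in the tree it is Littlewood's bound,
[MontgomeryVaughan2007, §13.2.1 Exercise 2 (b)], file `DirichletLogDerivGRHLogPowerBound.lean`, whose
`LittlewoodGRH.norm_logDeriv_LFunction_le_mul_log_of_rh` is exactly the `o(log|t|)` hypothesis binder of
`lagarias2005_thm_5_2_2_of_logDeriv`).
[cite: Lagarias2005, Theorem 5.2 (2) (arXiv p. 10 L134–141; proof L152–165)] -/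
theorem lagarias2005_thm_5_2_2_holds : lagarias2005_thm_5_2_2 :=
  lagarias2005_thm_5_2_2_of_logDeriv LittlewoodGRH.norm_logDeriv_LFunction_le_mul_log_of_rh

namespace Lagarias2005CharSpacing

/-! ## J. The endpoint `|h| = ½` through the AVERAGED phase-lattice lemma; Theorem 5.2 (1) by name

Lagarias (arXiv p. 10 L152–175) treats `|h| = ½` with the pointwise bound
`|L′/L(1 + iT, χ)| = O(log|T|/log log|T|)` "deducible from [IK04, Theorem 8.29]". The tree has no
pointwise `o(log|T|)` bound for `L′/L` on `Re s = 1`; instead the Markov-inequality form of the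
Theorem 4.1 argument (`Lagarias2005AvgSpacing.hasTrivialSpacingDistribution_of_phase_of_integral_pos`,
file `LagariasSpacingAveragedPhaseProofs.lean`) needs the velocity estimate only IN THE MEAN,
`∫_{−T}^{T} |v − ½ log|t|| = o(T log T)`, which Part G supplies from the mean-value bound
`∫_{−T}^{T} ‖L′/L(1 + it, χ)‖ dt = O(T)`; positivity of `v` is Hopf's lemma for the Hermite–Biehler
function `E_{½,θ}(·, χ)` (Lemma 5.1 (1)). Deviation from print: averaged instead of pointwise input at
the single value `|h| = ½`; the statement proved is Theorem 5.2 (1) as printed. -/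

section EndpointAssembly

variable {N : ℕ} [NeZero N] {χ : DirichletCharacter ℂ N}

/-- **Generic core of Theorems 4.1 / 5.2, averaged form.** Let `E` be entire with phase velocity
`v(t) = Re E′/E(½ + it) > 0` for every real `t` and `∫_{−T}^{T} |v(t) − ½ log|t|| dt ≤ η·T log T` for
`T ≥ T₀(η)`, every `η > 0`. Then for every `k` the `k` consecutive normalised zero spacings of
`A = ½(E + E♯)` and of `B = (i/2)(E − E♯)` have the trivial limiting distribution (polar phase
`exists_phase_critParts`, then the averaged phase-lattice lemma BY NAME).
[cite: Lagarias2005, Theorem 4.1, proof (arXiv pp. 8–9) and Theorem 5.2, proof (arXiv p. 10 L143–175)] -/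
theorem hasTrivialSpacingDistribution_critParts_of_velocity_integral {E : ℂ → ℂ}
    (hE : Differentiable ℂ E) (hpos : ∀ t : ℝ, 0 < (logDeriv E (1 / 2 + t * I)).re)
    (hint : ∀ η : ℝ, 0 < η → ∃ T₀ : ℝ, ∀ T : ℝ, T₀ ≤ T →
      (∫ t in (-T)..T, |(logDeriv E (1 / 2 + t * I)).re - 1 / 2 * Real.log (|t|)|) ≤ η * (T * Real.log T))
    (k : ℕ) :
    HasTrivialSpacingDistribution (critRePart E) k ∧ HasTrivialSpacingDistribution (critImPart E) k := by
  have hE0 : ∀ t : ℝ, E ((1 / 2 : ℂ) + t * I) ≠ 0 := fun t h0 ↦ by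
    have := hpos t
    simp only [logDeriv_apply, h0, div_zero, zero_re] at this
    exact lt_irrefl _ this
  obtain ⟨Ψ, hΨ, hzA, hzB⟩ := exists_phase_critParts hE hE0
  -- the velocity `v(t) = Re E'/E(½ + it)` as a function
  obtain ⟨v, hvdef⟩ : ∃ v : ℝ → ℝ, v = fun t : ℝ ↦ (logDeriv E ((1 / 2 : ℂ) + t * I)).re := ⟨_, rfl⟩
  have hvpt : ∀ t : ℝ, (logDeriv E (1 / 2 + t * I)).re = v t := fun t ↦ by rw [hvdef]
  have hpos' : ∀ t : ℝ, 0 < v t := fun t ↦ by rw [← hvpt]; exact hpos t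
  have hint' : ∀ η : ℝ, 0 < η → ∃ T₀ : ℝ, ∀ T : ℝ, T₀ ≤ T →
      (∫ t in (-T)..T, |v t - 1 / 2 * Real.log (|t|)|) ≤ η * (T * Real.log T) := by
    intro η hη
    obtain ⟨T₀, hT₀⟩ := hint η hη
    refine ⟨T₀, fun T hT ↦ ?_⟩
    have e : (fun t : ℝ ↦ |v t - 1 / 2 * Real.log (|t|)|) =
        fun t : ℝ ↦ |(logDeriv E (1 / 2 + t * I)).re - 1 / 2 * Real.log (|t|)| := by
      funext t; rw [hvpt]
    rw [e]
    exact hT₀ T hT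
  have hcontv : Continuous v := by rw [hvdef]; exact continuous_re_logDeriv_critLine hE hE0
  -- the averaged phase-lattice layer
  have hΨ' : ∀ t, HasDerivAt Ψ (v t) t := fun t ↦ by rw [← hvpt]; exact hΨ t
  have hΨA : ∀ t, HasDerivAt (fun t ↦ Ψ t + π / 2) (v t) t := fun t ↦ (hΨ' t).add_const _
  exact ⟨Lagarias2005AvgSpacing.hasTrivialSpacingDistribution_of_phase_of_integral_pos hΨA hcontv hpos' hint' hzA k,
    Lagarias2005AvgSpacing.hasTrivialSpacingDistribution_of_phase_of_integral_pos hΨ' hcontv hpos' hint' hzB k⟩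

/-- **Lagarias 2005, Theorem 5.2 (1) at the endpoint `h = ½` — UNCONDITIONAL** (every real `θ`, every
`k`): positivity of the velocity `Re ξ′/ξ(1 + it, χ)` is Hopf's lemma for the Hermite–Biehler function
`E_{½,θ}(·, χ)` (`re_logDeriv_pos_of_critHB` with `diffXiCharErot_critHB`, Lemma 5.1 (1)); the velocity
estimate in the mean is `integral_abs_velocity_half_sub_le_mul_log`; then the averaged generic core.
[cite: Lagarias2005, Theorem 5.2 (1), proof (arXiv p. 10 L143–175)] -/
theorem hasTrivialSpacingDistribution_diffXiChar_half (hχ : χ.IsPrimitive) (h1 : χ ≠ 1)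
    (θ : ℝ) (k : ℕ) :
    HasTrivialSpacingDistribution (diffXiCharArot χ (1 / 2) θ) k ∧
      HasTrivialSpacingDistribution (diffXiCharBrot χ (1 / 2) θ) k := by
  have hEd : Differentiable ℂ (diffXiCharErot χ (1 / 2) θ) := differentiable_diffXiCharErot h1 _ θ
  have hpos : ∀ t : ℝ, 0 < (logDeriv (diffXiCharErot χ (1 / 2) θ) (1 / 2 + t * I)).re := fun t ↦
    re_logDeriv_pos_of_critHB hEd (diffXiCharErot_critHB hχ h1 le_rfl θ)
      (diffXiCharErot_half_critLine_ne_zero hχ h1 θ t)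
  exact hasTrivialSpacingDistribution_critParts_of_velocity_integral hEd hpos
    (integral_abs_velocity_half_sub_le_mul_log hχ h1 θ) k

end EndpointAssembly

end Lagarias2005CharSpacing

/-- **Lagarias 2005, Theorem 5.2 (1)** — discharge of the named fact `lagarias2005_thm_5_2_1`
(RH-FREE; `χ` primitive non-principal, `k ≥ 1`, `|h| ≥ ½`, `0 ≤ θ < 2π`; proved for every real `θ`
and every `k`): `|h| > ½` is `hasTrivialSpacingDistribution_diffXiChar_of_half_lt` (the analogue of
Lemma 4.1 (1): `L′/L` bounded on `Re s = ½ + |h| > 1`); `|h| = ½` is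
`hasTrivialSpacingDistribution_diffXiChar_half` (velocity estimate in the mean + averaged phase
lattice, see Part J); `h < 0` reduces to `|h|` through the root number
(`hasTrivialSpacingDistribution_diffXiChar_of_abs`).
[cite: Lagarias2005, Theorem 5.2 (1) (arXiv p. 10 L124–133; proof L143–175)] -/
theorem lagarias2005_thm_5_2_1_holds : lagarias2005_thm_5_2_1 := by
  intro N _ χ hχ h1 k _ h θ hh _ _
  rcases hh.lt_or_eq with hlt | heq
  · exact hasTrivialSpacingDistribution_diffXiChar_of_half_lt hχ h1 hlt θ k
  · refine hasTrivialSpacingDistribution_diffXiChar_of_abs hχ h1 (fun θ' k' ↦ ?_) θ k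
    rw [← heq]
    exact hasTrivialSpacingDistribution_diffXiChar_half hχ h1 θ' k'


end Literature.NumberTheory.LFunctions
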